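import Summits.KontsevichZagierPeriods.KontsevichZagierPeriods.Theorems.LinRedNormalFormArrangementNormalFormSeparateEngine

/-!
# Stub `stub_rebaseSimplePosOnePos` (crux `ArrangementNormalForm`, line `janus-bands`) —
part `SepPred`: the separation engine with PROTECTED letters

A generalisation of `SeparatePos.sep_induction` (part `SeparateEngine`): partial fractions in
the distinguished base coordinate `y` of a representation of separation shape
`P(x', y)/∏ Lⱼ(x')^{eⱼ} · ∏ⱼ (y − λⱼ(x'))^{−dⱼ} · (fibre block)`, in which only the letters of a
chosen class `S` ("separable", a decidable predicate on the letter indices) are split from one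
another: repeatedly `1/((y−λ)(y−μ)) = (λ−μ)⁻¹ (1/(y−λ) − 1/(y−μ))` (rule 1b) for pairs of DISTINCT
ACTIVE SEPARABLE letters, each piece being the parent times the bounded factor
`(y − μ)/(λ − μ)` (`SeparatePos.exists_piece`, domination = the ratio condition `hwall`, required
for separable pairs only); the protected letters, the numerator and the fibre block are carried
unchanged. The induction runs on the total multiplicity of the separable letters; the terminal
class `T` receives the shapes all of whose active separable letters coincide
(`SeparatePos.sep_induction_pred`). With `S = ⊤` this is `sep_induction`.

Use (line `janus-bands`, `B = 2` corner calculus of `stub_rebaseSimplePosOnePos`): separating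
the FAR silent factors of a flat cell from one another in a generic direction (resultants are
units near the flat point, so the ratio condition holds after localisation), while the near
factors and the base pole — whose mutual resultants vanish at the flat point — stay protected.

References: M. Kontsevich, D. Zagier, *Periods* (2001), §1.2, rule (1b).
-/

noncomputable section

open Set MeasureTheory MvPolynomial

namespace Summit.KontsevichZagierPeriods.ArrangementNormalForm.JanusBands

open Literature.NumberTheory.Transcendental

namespace SeparatePos

section InductionPred

variable {b k m m' r : ℕ}

/-- Lowering the multiplicity of a separable letter lowers the total separable multiplicity by
one. -/
theorem sum_filter_update (S : Fin r → Prop) [DecidablePred S] (d : Fin r → ℕ) (i : Fin r) (hi : S i)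
    (hd : d i ≠ 0) {N : ℕ} (hN : ∑ j ∈ Finset.univ.filter S, d j = N + 1) :
    ∑ j ∈ Finset.univ.filter S, Function.update d i (d i - 1) j = N := by
  have hmem : i ∈ Finset.univ.filter S := Finset.mem_filter.2 ⟨Finset.mem_univ _, hi⟩
  rw [Finset.sum_update_of_mem hmem]
  have h1 := Finset.sum_eq_add_sum_sdiff_singleton_of_mem hmem d
  -- `h1 : ∑ filter = d i + ∑ (filter \ {i})`
  have h2 : ∑ x ∈ Finset.univ.filter S \ {i}, d x = N + 1 - d i := by omega
  rw [h2]
  omega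

/-- **Separation with protected letters** (induction on the total multiplicity of the
separable letters `S`). See the module docstring. Hypotheses on the active separable letters
only: non-vanishing on the domain (`hpole`) and the ratio condition for distinct pairs
(`hwall`); conclusion: `[s]` is congruent modulo `KZ.relations` to the subgroup generated by any
class `T` containing the shapes whose active separable letters all coincide (`hT`). -/
theorem sep_induction_pred (b k m' r : ℕ) (M : Fin m' → (Fin (b + 1) → ℚ) × ℚ)
    (p : MvPolynomial (Fin (b + 1)) ℚ) (lam : Fin r → (Fin b → ℚ) × ℚ)
    (a : Fin k → Option ((Fin (b + 1) → ℚ) × ℚ)) (lo hi : Fin k → Fin k ⊕ ((Fin (b + 1) → ℚ) × ℚ))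
    (S : Fin r → Prop) [DecidablePred S] (T : Set KZ.FormalRep)
    (hT : ∀ (m : ℕ) (L : Fin m → (Fin b → ℚ) × ℚ) (e : Fin m → ℕ) (d : Fin r → ℕ)
      (s : KZ.IntegralRep (b + 1 + k)), Bornology.IsBounded s.domain →
      s.domain = gDom b k m' M lo hi → EqOn s.integrand (shape b k p L e lam d a) s.domain →
      (∀ j, S j → d j ≠ 0 → ∀ z ∈ s.domain, z (Fin.castAdd k (Fin.last b)) - affB b k (lam j) z ≠ 0) →
      (∀ j j', S j → S j' → d j ≠ 0 → d j' ≠ 0 → lam j = lam j') → KZ.of s ∈ T)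
    (N : ℕ) :
    ∀ (m : ℕ) (L : Fin m → (Fin b → ℚ) × ℚ) (e : Fin m → ℕ) (d : Fin r → ℕ)
      (s : KZ.IntegralRep (b + 1 + k)), ∑ j ∈ Finset.univ.filter S, d j = N → Bornology.IsBounded s.domain →
      s.domain = gDom b k m' M lo hi → EqOn s.integrand (shape b k p L e lam d a) s.domain →
      (∀ j, S j → d j ≠ 0 → ∀ z ∈ s.domain, z (Fin.castAdd k (Fin.last b)) - affB b k (lam j) z ≠ 0) →
      (∀ j j', S j → S j' → d j ≠ 0 → d j' ≠ 0 → lam j ≠ lam j' → ∃ C, ∀ z ∈ s.domain,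
        |z (Fin.castAdd k (Fin.last b)) - affB b k (lam j') z| ≤
          C * |affB b k (lam j) z - affB b k (lam j') z|) →
      ∃ c ∈ AddSubgroup.closure T, KZ.of s - c ∈ KZ.relations := by
  induction N with
  | zero =>
    intro m L e d s hN hbd hdom hint hpole _
    have hd : ∀ j, S j → d j = 0 := fun j hj =>
      (Finset.sum_eq_zero_iff.mp hN) j (Finset.mem_filter.2 ⟨Finset.mem_univ _, hj⟩)
    exact ⟨KZ.of s, AddSubgroup.subset_closure (hT m L e d s hbd hdom hint hpole
      fun j j' hj _ hdj _ => absurd (hd j hj) hdj), by simp⟩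
  | succ N ih =>
    intro m L e d s hN hbd hdom hint hpole hwall
    by_cases hsplit : ∃ j j', S j ∧ S j' ∧ d j ≠ 0 ∧ d j' ≠ 0 ∧ lam j ≠ lam j'
    · obtain ⟨j, j', hSj, hSj', hj, hj', hne⟩ := hsplit
      obtain ⟨C₁, hC₁⟩ := hwall j j' hSj hSj' hj hj' hne
      obtain ⟨C₂, hC₂⟩ := hwall j' j hSj' hSj hj' hj hne.symm
      obtain ⟨s₁, hd₁, hg₁, hi₁⟩ := exists_piece L e p lam d a s hint j j' hj' (hpole j' hSj' hj') hC₁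
      obtain ⟨s₂, hd₂, hg₂, hi₂⟩ := exists_piece L e p lam d a s hint j' j hj (hpole j hSj hj) hC₂
      have hrel : KZ.of s - KZ.of s₁ - KZ.of s₂ ∈ KZ.relations := by
        refine KZ.integrandAddRel_subset_relations ⟨_, s, s₁, s₂, hd₁, hd₂, fun z hz => ?_, rfl⟩
        have hR : affB b k (lam j) z - affB b k (lam j') z ≠ 0 := fun h => hpole j' hSj' hj' z hz
          (abs_eq_zero.mp (le_antisymm (by simpa [h] using hC₁ z hz) (abs_nonneg _)))
        have key : (z (Fin.castAdd k (Fin.last b)) - affB b k (lam j') z) /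
              (affB b k (lam j) z - affB b k (lam j') z) +
            (z (Fin.castAdd k (Fin.last b)) - affB b k (lam j) z) /
              (affB b k (lam j') z - affB b k (lam j) z) = 1 := by
          rw [show affB b k (lam j') z - affB b k (lam j) z =
              -(affB b k (lam j) z - affB b k (lam j') z) by ring, div_neg, ← sub_eq_add_neg,
            ← sub_div, div_eq_one_iff_eq hR]
          ring
        rw [Pi.add_apply, hg₁, hg₂, ← mul_add, key, mul_one]
      obtain ⟨c₁, hc₁, hr₁⟩ := ih (m + 1) _ _ _ s₁ (sum_filter_update S d j' hSj' hj' hN) (by rw [hd₁]; exact hbd)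
        (hd₁.trans hdom) hi₁
        (fun i hi hdi z hz => hpole i hi (ne_zero_of_update_ne_zero hdi) z (by rw [← hd₁]; exact hz))
        (fun i i' hi hi' hdi hdi' hii' => by
          obtain ⟨C', hb'⟩ := hwall i i' hi hi' (ne_zero_of_update_ne_zero hdi)
            (ne_zero_of_update_ne_zero hdi') hii'
          exact ⟨C', fun z hz => hb' z (by rw [← hd₁]; exact hz)⟩)
      obtain ⟨c₂, hc₂, hr₂⟩ := ih (m + 1) _ _ _ s₂ (sum_filter_update S d j hSj hj hN) (by rw [hd₂]; exact hbd)
        (hd₂.trans hdom) hi₂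
        (fun i hi hdi z hz => hpole i hi (ne_zero_of_update_ne_zero hdi) z (by rw [← hd₂]; exact hz))
        (fun i i' hi hi' hdi hdi' hii' => by
          obtain ⟨C', hb'⟩ := hwall i i' hi hi' (ne_zero_of_update_ne_zero hdi)
            (ne_zero_of_update_ne_zero hdi') hii'
          exact ⟨C', fun z hz => hb' z (by rw [← hd₂]; exact hz)⟩)
      refine ⟨c₁ + c₂, add_mem hc₁ hc₂, ?_⟩
      have : KZ.of s - (c₁ + c₂) =
          (KZ.of s - KZ.of s₁ - KZ.of s₂) + (KZ.of s₁ - c₁) + (KZ.of s₂ - c₂) := by abel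
      rw [this]
      exact add_mem (add_mem hrel hr₁) hr₂
    · push Not at hsplit
      exact ⟨KZ.of s, AddSubgroup.subset_closure (hT m L e d s hbd hdom hint hpole
        fun j j' hj hj' hdj hdj' => hsplit j j' hj hj' hdj hdj'), by simp⟩

/-- `sep_induction_pred` without the multiplicity counter. -/
theorem sep_of_pred (M : Fin m' → (Fin (b + 1) → ℚ) × ℚ)
    (p : MvPolynomial (Fin (b + 1)) ℚ) (lam : Fin r → (Fin b → ℚ) × ℚ)
    (a : Fin k → Option ((Fin (b + 1) → ℚ) × ℚ)) (lo hi : Fin k → Fin k ⊕ ((Fin (b + 1) → ℚ) × ℚ))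
    (S : Fin r → Prop) [DecidablePred S] (T : Set KZ.FormalRep)
    (hT : ∀ (m : ℕ) (L : Fin m → (Fin b → ℚ) × ℚ) (e : Fin m → ℕ) (d : Fin r → ℕ)
      (s : KZ.IntegralRep (b + 1 + k)), Bornology.IsBounded s.domain →
      s.domain = gDom b k m' M lo hi → EqOn s.integrand (shape b k p L e lam d a) s.domain →
      (∀ j, S j → d j ≠ 0 → ∀ z ∈ s.domain, z (Fin.castAdd k (Fin.last b)) - affB b k (lam j) z ≠ 0) →
      (∀ j j', S j → S j' → d j ≠ 0 → d j' ≠ 0 → lam j = lam j') → KZ.of s ∈ T)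
    (L : Fin m → (Fin b → ℚ) × ℚ) (e : Fin m → ℕ) (d : Fin r → ℕ) (s : KZ.IntegralRep (b + 1 + k))
    (hbd : Bornology.IsBounded s.domain) (hdom : s.domain = gDom b k m' M lo hi)
    (hint : EqOn s.integrand (shape b k p L e lam d a) s.domain)
    (hpole : ∀ j, S j → d j ≠ 0 → ∀ z ∈ s.domain, z (Fin.castAdd k (Fin.last b)) - affB b k (lam j) z ≠ 0)
    (hwall : ∀ j j', S j → S j' → d j ≠ 0 → d j' ≠ 0 → lam j ≠ lam j' → ∃ C, ∀ z ∈ s.domain,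
      |z (Fin.castAdd k (Fin.last b)) - affB b k (lam j') z| ≤ C * |affB b k (lam j) z - affB b k (lam j') z|) :
    ∃ c ∈ AddSubgroup.closure T, KZ.of s - c ∈ KZ.relations :=
  sep_induction_pred b k m' r M p lam a lo hi S T hT _ m L e d s rfl hbd hdom hint hpole hwall

end InductionPred

end SeparatePos

/-- **Registered part of `stub_rebaseSimplePosOnePos` (line `janus-bands`): the separation
engine with protected letters** (`SeparatePos.sep_of_pred`, any base dimension `b` and fibre
number `k`). A bounded representation of separation shape
`P(x', y)/∏ Lⱼ(x')^{eⱼ} · ∏ⱼ (y − λⱼ(x'))^{−dⱼ} · (fibre block)` over a literal domain whose active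
letters of a class `S` do not vanish on the domain and satisfy the ratio condition
`|y − λ_{j'}| ≤ C |λ_j − λ_{j'}|` pairwise (distinct letters of `S` only) is congruent modulo
`KZ.relations` to the subgroup generated by any class `T` containing the shapes (same domain,
numerator, letters, fibre block; more `x'`-denominators) all of whose active `S`-letters
coincide — repeated rule (1b) with bounded multipliers `(y − λ_{j'})/(λ_j − λ_{j'})`. -/
theorem rebaseSimplePos_sepOfPred (b k m m' r : ℕ) (M : Fin m' → (Fin (b + 1) → ℚ) × ℚ) (p : MvPolynomial (Fin (b + 1)) ℚ) (lam : Fin r → (Fin b → ℚ) × ℚ) (a : Fin k → Option ((Fin (b + 1) → ℚ) × ℚ)) (lo hi : Fin k → Fin k ⊕ ((Fin (b + 1) → ℚ) × ℚ)) (S : Fin r → Prop) [DecidablePred S] (T : Set KZ.FormalRep) (hT : ∀ (m : ℕ) (L : Fin m → (Fin b → ℚ) × ℚ) (e : Fin m → ℕ) (d : Fin r → ℕ) (s : KZ.IntegralRep (b + 1 + k)), Bornology.IsBounded s.domain → s.domain = SeparatePos.gDom b k m' M lo hi → Set.EqOn s.integrand (SeparatePos.shape b k p L e lam d a) s.domain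 → (∀ j, S j → d j ≠ 0 → ∀ z ∈ s.domain, z (Fin.castAdd k (Fin.last b)) - SeparatePos.affB b k (lam j) z ≠ 0) → (∀ j j', S j → S j' → d j ≠ 0 → d j' ≠ 0 → lam j = lam j') → KZ.of s ∈ T) (L : Fin m → (Fin b → ℚ) × ℚ) (e : Fin m → ℕ) (d : Fin r → ℕ) (s : KZ.IntegralRep (b + 1 + k)) (hbd : Bornology.IsBounded s.domain) (hdom : s.domain = SeparatePos.gDom b k m' M lo hi) (hint : Set.EqOn s.integrand (SeparatePos.shape b k p L e lam d a) s.domain) (hpole : ∀ j, S j → d j ≠ 0 → ∀ z ∈ s.domain, z (Fin.castAdd k (Fin.last b)) - SeparatePos.affB b k (lam j) z ≠ 0) (hwall : ∀ j j', S j → S j' → d j ≠ 0 → d j' ≠ 0 → lam j ≠ lam j' → ∃ C : ℝ, ∀ z ∈ s.domain, |z (Fin.castAdd k (Fin.last b)) - SeparatePos.affB b k (lam j') z| ≤ C * |SeparatePos.affB b k (lam j) z - SeparatePos.affB b k (lam j') z|) : ∃ c ∈ AddSubgroup.closure T, KZ.of s - c ∈ KZ.relations :=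
  SeparatePos.sep_of_pred M p lam a lo hi S T hT L e d s hbd hdom hint hpole hwall

end Summit.KontsevichZagierPeriods.ArrangementNormalForm.JanusBands
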